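import Literature.AnabelianGeometry.EtaleTheta.SettingModelChiNoCommAxisCusp
import Literature.AnabelianGeometry.EtaleTheta.SettingModelKrullThm16i
import HarnessLib

/-!
# [SemiAnbd] Thm. 6.5 (iii) AS TYPED (`IsoPreservesCuspidalDecomp`, «isomorphisms preserve cuspidal decomposition
# groups» for EVERY topological isomorphism) FAILS at the cusped untwisted Krull model `modelκ′` — although
# [EtTh] Thm. 1.6 (i) holds there: the K3 chain's hypothesis `h65` is idle at the only `IsThm16Origin` model

Mochizuki, *Semi-graphs of anabelioids*, Publ. RIMS **42** (2006) [SemiAnbd], Thm. 6.5 (iii) p. 71; *The étale theta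
function …* [EtTh], Thm. 1.6 (i) p. 24. Cell abc-iut, layer L2 (NV lane), seat abc-iut-w5-d165 (gen 4); PROOF-ONLY
(0 definitions). At `modelκ′` (`Π^tp_X = Γ ⋊_{θ∘1} G_{ℚ_p}`, cusp decomposition groups = conjugates of `c^Ẑ ⋊ G_{ℚ_p}`)
take `φ := χ(σ₀) ∈ Aut(Ẑ)` with `φ ∉ {±1}` (this seat's `exists_chi_ne_one_ne_negOneAut`) and the topological automorphism
`α_φ : (n, σ) ↦ (θ_φ n, σ)` (`exists_twistκ` — the action is trivial, so `twistGfp φ × id` IS an automorphism; it even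
preserves `Δ^tp_X`). If `α_φ(c^Ẑ ⋊ G)` were a cuspidal decomposition group `h (c^Ẑ ⋊ G) h⁻¹`, then `θ_φ(c)` would be
`Γ`-conjugate into `c^Ẑ` — excluded by this seat's lamplighter obstruction `eq_one_or_eq_negOneAut_of_isConj_twist_cElt`.

* `exists_twistκ` — `α_φ : Π^tp_X ≃ₜ* Π^tp_X` with `(α g).left = θ_φ g.left`, `(α g).right = g.right`;
* **`not_isoPreservesCuspidalDecomp_modelκ'`** — `¬ (modelκ′ p).IsoPreservesCuspidalDecomp (modelκ′ p)`;
* `exists_deltaPreserving_not_preserves_cuspidal_modelκ'` — the witness is even `Δ`-preserving;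
* census corollary `isThm16Origin_and_forall_thm16i_and_not_h65_modelκ'`: at `modelκ′` the K3 hypothesis bundle
  `IsThm16Origin` holds (p442699), the CONCLUSION `Thm16i γ` holds for every `Δ`-preserving `γ` (p445125), and the
  chain's remaining hypothesis `h65` is FALSE — so `IsThm16Origin.thm16i` never fires at `α = β = modelκ′`, and `h65` as
  typed (all topological isomorphisms, not only those induced by isomorphisms of curves) is not a necessary condition.

SEMI-SYNTHETIC model = consistency evidence only; nothing of [SemiAnbd]/[EtTh] is asserted or denied for genuine tempered
fundamental groups (there Thm. 6.5 (iii) concerns isomorphisms arising from the curves). No side taken on [IUTchIII]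
Cor. 3.12; typed ≠ proved.
-/

noncomputable section

namespace Literature.AnabelianGeometry.EtaleTheta.SettingModel

open Literature.AnabelianGeometry.SemiGraphs Function _root_.Topology
open scoped commutatorElement Pointwise

variable (p : ℕ) [hp : Fact p.Prime]

/-- **`α_φ := θ_φ × id` is a topological automorphism of `Γ ⋊_{θ∘1} G_{ℚ_p}`** (trivial action).
[cite: MochizukiEtTh2009, §1 p.13] -/
theorem exists_twistκ (φ : MulAut ZH) :
    ∃ α : PiTpκ p ≃ₜ* PiTpκ p, ∀ g : PiTpκ p, (α g).left = twistGfp φ g.left ∧ (α g).right = g.right := by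
  let f : ∀ _ : MulAut ZH, PiTpκ p → PiTpκ p := fun ψ g => ⟨twistGfp ψ g.left, g.right⟩
  have hf_mul : ∀ (ψ : MulAut ZH) (g h : PiTpκ p), f ψ (g * h) = f ψ g * f ψ h := fun ψ g h => by
    refine SemidirectProduct.ext ?_ ?_
    · change twistGfp ψ (g * h).left = twistGfp ψ g.left * actκ p g.right (twistGfp ψ h.left)
      rw [SemidirectProduct.mul_left, actκ_apply_eq, actκ_apply_eq, map_mul]
    · rfl
  have hf_inv : ∀ (ψ : MulAut ZH) (g : PiTpκ p), f ψ⁻¹ (f ψ g) = g := fun ψ g => by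
    refine SemidirectProduct.ext ?_ rfl
    change twistGfp ψ⁻¹ (twistGfp ψ g.left) = g.left
    rw [map_inv, MulAut.inv_apply_self]
  have hf_cont : ∀ ψ : MulAut ZH, Continuous (f ψ) := fun ψ =>
    (isInducing_leftRightκ p).continuous_iff.mpr
      (((continuous_twistGfp ψ).comp (Semidirect.continuous_left (isInducing_leftRightκ p))).prodMk
        (Semidirect.continuous_right (isInducing_leftRightκ p)))
  let e : PiTpκ p ≃* PiTpκ p :=
    { toFun := f φ
      invFun := f φ⁻¹
      left_inv := hf_inv φ
      right_inv := fun g => by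
        have h := hf_inv φ⁻¹ g
        rwa [inv_inv] at h
      map_mul' := hf_mul φ }
  exact ⟨ContinuousMulEquiv.mk e (hf_cont φ) (hf_cont φ⁻¹), fun g => ⟨rfl, rfl⟩⟩

/-- **[SemiAnbd] Thm. 6.5 (iii) as typed FAILS at `modelκ′`**: the topological automorphism `α_φ = θ_φ × id`
(`φ = χ(σ₀) ∉ {±1}`) carries the cusp decomposition group `c^Ẑ ⋊ G_{ℚ_p}` to a subgroup that is NOT a conjugate of
it — `θ_φ(c)` is not `Γ`-conjugate into `c^Ẑ` (lamplighter obstruction). [cite: MochizukiSemiAnbd2006, §6 p.71] -/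
theorem not_isoPreservesCuspidalDecomp_modelκ' :
    ¬ (ThetaSetting.modelκ' p).IsoPreservesCuspidalDecomp (ThetaSetting.modelκ' p).toTemperedCurve := by
  intro h65
  obtain ⟨σ₀, h1, h2⟩ := exists_chi_ne_one_ne_negOneAut p
  obtain ⟨α, hα⟩ := exists_twistκ p (chi p σ₀)
  have hD : (ThetaSetting.modelκ' p).IsCuspidalDecompositionGroup (cuspDecompκ p) :=
    ⟨(), trivial, 1, by rw [one_smul]⟩
  obtain ⟨_, -, h, hEq⟩ := (h65 α (cuspDecompκ p)).1 hD
  have hmem : α (SemidirectProduct.inl (cPowGfp (iotaZ (Multiplicative.ofAdd 1)))) ∈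
      (cuspDecompκ p).map α.toMulEquiv.toMonoidHom :=
    ⟨SemidirectProduct.inl (cPowGfp (iotaZ (Multiplicative.ofAdd 1))),
      (mem_cuspDecompκ_iff p _).mpr (by rw [SemidirectProduct.left_inl]; exact ⟨_, rfl⟩), rfl⟩
  rw [hEq] at hmem
  change _ ∈ h • cuspDecompκ p at hmem
  rw [mem_conjAct_smul_cuspDecompκ_iff, (hα _).1, SemidirectProduct.left_inl,
    Subgroup.mem_smul_pointwise_iff_exists] at hmem
  obtain ⟨z, hz, hzeq⟩ := hmem
  rw [MulAut.smul_def, MulAut.conj_apply] at hzeq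
  have e := congrArg gfpFst hzeq
  simp only [map_mul, map_inv, gfpFst_twistGfp, gfpFst_cPowGfp, cPow_spec] at e
  have hzax : gfpFst z ∈ cAxis := by
    rw [← map_gfpFst_cAxisGfp]; exact Subgroup.mem_map_of_mem _ hz
  have hc : IsConj (twist (chi p σ₀) (eta cElt)) (gfpFst z) := by
    refine isConj_iff.mpr ⟨(gfpFst (ConjAct.ofConjAct h).left)⁻¹, ?_⟩
    rw [← e]
    group
  rcases eq_one_or_eq_negOneAut_of_isConj_twist_cElt (chi p σ₀) hzax hc with h' | h'
  · exact h1 h'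
  · exact h2 h'

/-- The witness is even `Δ`-preserving: **some `Δ`-preserving topological automorphism of `Π^tp_X` at `modelκ′` carries a
cuspidal decomposition group to a NON-cuspidal subgroup.** [cite: MochizukiSemiAnbd2006, §6 p.71] -/
theorem exists_deltaPreserving_not_preserves_cuspidal_modelκ' :
    ∃ α : (ThetaSetting.modelκ' p).PiTemp ≃ₜ* (ThetaSetting.modelκ' p).PiTemp,
      (ThetaSetting.modelκ' p).DeltaTemp.map α.toMulEquiv.toMonoidHom = (ThetaSetting.modelκ' p).DeltaTemp ∧
      ∃ D : Subgroup (ThetaSetting.modelκ' p).PiTemp, (ThetaSetting.modelκ' p).IsCuspidalDecompositionGroup D ∧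
        ¬ (ThetaSetting.modelκ' p).IsCuspidalDecompositionGroup (D.map α.toMulEquiv.toMonoidHom) := by
  obtain ⟨σ₀, h1, h2⟩ := exists_chi_ne_one_ne_negOneAut p
  obtain ⟨α, hα⟩ := exists_twistκ p (chi p σ₀)
  refine ⟨α, ?_, cuspDecompκ p, ⟨(), trivial, 1, by rw [one_smul]⟩, ?_⟩
  · ext g
    constructor
    · rintro ⟨g', hg', rfl⟩
      change α g' ∈ (curveκ' p).DeltaTemp
      exact (mem_deltaTempκ_iff p _).mpr (((hα g').2).trans ((mem_deltaTempκ_iff p g').mp hg'))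
    · intro hg
      refine ⟨α.symm g, ?_, α.apply_symm_apply g⟩
      change α.symm g ∈ (curveκ' p).DeltaTemp
      refine (mem_deltaTempκ_iff p _).mpr ?_
      have h := (hα (α.symm g)).2
      rw [α.apply_symm_apply] at h
      exact h.symm.trans ((mem_deltaTempκ_iff p g).mp hg)
  · rintro ⟨_, -, h, hEq⟩
    have hmem : α (SemidirectProduct.inl (cPowGfp (iotaZ (Multiplicative.ofAdd 1)))) ∈
        (cuspDecompκ p).map α.toMulEquiv.toMonoidHom :=
      ⟨SemidirectProduct.inl (cPowGfp (iotaZ (Multiplicative.ofAdd 1))),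
        (mem_cuspDecompκ_iff p _).mpr (by rw [SemidirectProduct.left_inl]; exact ⟨_, rfl⟩), rfl⟩
    rw [hEq] at hmem
    change _ ∈ h • cuspDecompκ p at hmem
    rw [mem_conjAct_smul_cuspDecompκ_iff, (hα _).1, SemidirectProduct.left_inl,
      Subgroup.mem_smul_pointwise_iff_exists] at hmem
    obtain ⟨z, hz, hzeq⟩ := hmem
    rw [MulAut.smul_def, MulAut.conj_apply] at hzeq
    have e := congrArg gfpFst hzeq
    simp only [map_mul, map_inv, gfpFst_twistGfp, gfpFst_cPowGfp, cPow_spec] at e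
    have hzax : gfpFst z ∈ cAxis := by
      rw [← map_gfpFst_cAxisGfp]; exact Subgroup.mem_map_of_mem _ hz
    have hc : IsConj (twist (chi p σ₀) (eta cElt)) (gfpFst z) := by
      refine isConj_iff.mpr ⟨(gfpFst (ConjAct.ofConjAct h).left)⁻¹, ?_⟩
      rw [← e]
      group
    rcases eq_one_or_eq_negOneAut_of_isConj_twist_cElt (chi p σ₀) hzax hc with h' | h'
    · exact h1 h'
    · exact h2 h'

/-- **Census corollary**: at `modelκ′` the K3 chain's hypothesis bundle `IsThm16Origin` holds, its conclusion
«Thm. 1.6 (i) for every `Δ`-preserving `γ`» holds, and its remaining hypothesis `h65 = IsoPreservesCuspidalDecomp` is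
FALSE — `h65` (as typed) is idle at the only model of the bundle. [cite: MochizukiEtTh2009, Thm 1.6 (i) p.24] -/
theorem isThm16Origin_and_forall_thm16i_and_not_h65_modelκ' :
    (ThetaSetting.modelκ' p).IsThm16Origin ∧
      (∀ γ : (ThetaSetting.modelκ' p).PiTemp ≃ₜ* (ThetaSetting.modelκ' p).PiTemp,
        (ThetaSetting.modelκ' p).DeltaTemp.map γ.toMulEquiv.toMonoidHom = (ThetaSetting.modelκ' p).DeltaTemp →
          ThetaSetting.Thm16i γ) ∧
      ¬ (ThetaSetting.modelκ' p).IsoPreservesCuspidalDecomp (ThetaSetting.modelκ' p).toTemperedCurve :=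
  ⟨ThetaSetting.modelκ'_isThm16Origin p, fun γ hΔ => modelκ'_thm16i p γ hΔ, not_isoPreservesCuspidalDecomp_modelκ' p⟩

/-! ## v2 (append-only). The origin-certificate reading: F-1704 EXCLUDES `modelκ′` -/

/-- **No origin certificate for which [SemiAnbd] Thm. 6.5 (iii) is assumed (the tree's FACT form
`TemperedOrigin.CuspidalAbsolutenessHolds`, F-1704) certifies `modelκ′`.** For every `Ω : TemperedOrigin p` with
`Ω.IsHyperbolicCurveOrigin (modelκ′ p).toTemperedCurve`, `Ω.CuspidalAbsolutenessHolds` FAILS (instantiate the ∀ at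
`X = Y = modelκ′`). Reading: F-1704 has teeth — it detects the semi-synthetic κ′-carrier as non-genuine; nothing about the
fact for genuine curves is touched. [cite: MochizukiSemiAnbd2006, Thm 6.5(iii) p.72] -/
theorem not_cuspidalAbsolutenessHolds_of_origin_modelκ' (Ω : TemperedOrigin p)
    (hΩ : Ω.IsHyperbolicCurveOrigin (ThetaSetting.modelκ' p).toTemperedCurve) : ¬ Ω.CuspidalAbsolutenessHolds :=
  fun h65 => not_isoPreservesCuspidalDecomp_modelκ' p (h65 _ _ hΩ hΩ)

/-- Contrapositive: an origin class `Ω` for which F-1704 holds does NOT contain `modelκ′` — consumers of the K3 chain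
through `(h65 : Ω.CuspidalAbsolutenessHolds)` (abc-iut-L3's `TemperedAbsolutenessReductionsConverse`) can never
specialise to `α = β = modelκ′`. [cite: MochizukiSemiAnbd2006, Thm 6.5(iii) p.72] -/
theorem not_isHyperbolicCurveOrigin_modelκ'_of_cuspidalAbsolutenessHolds (Ω : TemperedOrigin p)
    (h65 : Ω.CuspidalAbsolutenessHolds) : ¬ Ω.IsHyperbolicCurveOrigin (ThetaSetting.modelκ' p).toTemperedCurve :=
  fun hΩ => not_cuspidalAbsolutenessHolds_of_origin_modelκ' p Ω hΩ h65

end Literature.AnabelianGeometry.EtaleTheta.SettingModel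

end
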